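import Summits.BirchSwinnertonDyer.Rank1Residual.X5.KatoOrdTwoMuPart
import Summits.BirchSwinnertonDyer.BirchSwinnertonDyer.Theses.ByReductionTypeAtTwo
import HarnessLib

/-!
# Route ByReductionTypeAtTwo (K4): the aside `AsideKatoMuPartAtTwoOfTowerGap` closed BY NAME

Seat `cruxlead-stmt-BirchSwinnertonDyer-19573` (LEAD PROVER, MODE LINE, line `steinberg-fibre-at-two`; HOME
`run/shared/lean/pub/bsd-2adic/`). HONEST FRAMING (cell bsd-2adic): BSD is not proved by any of this, and neither
the crux `OrdKatoHalfAtTwoIso` (stmt-BirchSwinnertonDyer-19573) nor its child B7 `OrdKatoMuPartOptimalAtTwo`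
(stmt-BirchSwinnertonDyer-23780) is touched here. This file closes only the route ASIDE item
stmt-BirchSwinnertonDyer-23781, which DECLARES the conjecture leaf `X5.O1.KatoMuPartAtTwo` reached through child B7
(K4 rev 28/29): its text is literally the X5 kernel theorem `X5.O1.katoMuPartAtTwo_of_towerGapAtTwo` («tower-gap
certificate `μ₂ = 0` ⇒ Kato `μ`-part at `2`», i.e. `2^0 = 1 ∣ L₀`), applied once. No conjecture content is added
or discharged: `KatoMuPartAtTwo W` itself stays an `@[conjecture]` obligation off the tower-gap locus.
-/

set_option linter.dupNamespace false

namespace Summit.BirchSwinnertonDyer.BirchSwinnertonDyer.Theorems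

open Summit.BirchSwinnertonDyer.BirchSwinnertonDyer.Theses.ByReductionTypeAtTwo

/-- **K4 aside `AsideKatoMuPartAtTwoOfTowerGap` (route `ByReductionTypeAtTwo`, item stmt-BirchSwinnertonDyer-23781),
proved by name:** for every globally minimal elliptic `W/ℚ`, the tower-gap certificate `X5.O1.TowerGapAtTwo W`
(`μ₂ = 0` read off the `ℤ₂`-tower) implies Kato's `μ`-part statement `X5.O1.KatoMuPartAtTwo W` — one application
of the X5 kernel theorem `X5.O1.katoMuPartAtTwo_of_towerGapAtTwo` (every cyclotomic Selmer dual datum has `μ = 0`,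
hence `2^{μ(X)} = 1 ∣ L₀`). Nothing about BSD, the crux 202 or its child B7 is asserted. [folklore] -/
theorem asideKatoMuPartAtTwoOfTowerGap_proof : AsideKatoMuPartAtTwoOfTowerGap :=
  fun W _ _ hgap => Summit.BirchSwinnertonDyer.Rank1Residual.X5.O1.katoMuPartAtTwo_of_towerGapAtTwo W hgap

end Summit.BirchSwinnertonDyer.BirchSwinnertonDyer.Theorems
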